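import Literature.MathematicalPhysics.QuantumFieldTheory.Balaban1983to89.B12CondIIIJ

/-!
# Bałaban, *Renormalization group approach to lattice gauge field theories. I* (CMP 109, 1987) [B12] — p. 272, the
# function (3.13): the `𝐉`-SLOT of its membership in the analyticity space (condition (iii) (1.14), «|𝐉| < γ₀»,
# `γ₀ = α₀`) — KERNEL-CHECKED ARITHMETIC

THE PRINT.  B12 p. 272 [PDF 24]: *«D^{ξ*}_{exp iξ𝐀U} ξ⁻²π Im ∂ exp iξ𝐀U = D^{ξ*}_D ⟦sic: subscript D printed; read
D^{ξ*}_U, cf. (3.12)⟧ ξ⁻²π Im ∂U + D^{ξ*}_U D^ξ_U 𝐀 + 𝐅(U, 𝐀),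
(3.11) where 𝐅 is a local operator depending on U, ∂U, 𝐀, ∇^ξ_U𝐀 only.»* … *«We have D^{ξ*}_{U_{k+1}} ξ⁻²π Im ∂U_{k+1} =
(L^{j−1}η)³J_{k+1}, (3.12) and we replace J_{k+1} by the variable 𝐉, and in the remaining expressions we replace U_{k+1}
by the new variable 𝐔. Thus we obtain the following function of the variables 𝐔, 𝐉  𝐄^{(j)}(X, exp iξ𝐀𝐔, (L^{j−1}η)³𝐉 +
Δ^ξ_𝐔𝐀 − P₁𝐀 + 𝐅₁(𝐔, 𝐀)). (3.13) We consider it on the space U^c_j(X, 1/2α₀, 1/2α₁, α₀) (notice the different constant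
in the bound for 𝐉). It is an analytic function on this space, and also an analytic function of 𝐀, for 𝐀, ∇^ξ_𝐔𝐀, Δ^ξ_𝐔𝐀
sufficiently small. These restrictions can be easily obtained from the definition of the spaces, and from the form of
the expressions in (3.13). Thus, there exists a constant α₂, depending on α₀ and on some absolute constants, such that
the function (3.13) is analytic in 𝐀, for 𝐀 satisfying the conditions |𝐀|, |P₁𝐀|, |∇^ξ_𝐔𝐀|, |Δ^ξ_𝐔𝐀| < α₂ on X. (3.14)»*;
p. 262 [PDF 14]: *«(iii) The configurations 𝐔, 𝐉 satisfy the bounds |∂𝐔 − 1| < α₀ξ², |𝐉| < γ₀ on X. (1.14)»*; p. 263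
[PDF 15]: *«Usually we consider spaces with γ₀ = α₀, and then we omit the constant γ₀ from the symbol denoting the
space.»*; p. 279 [PDF 31]: *«Let us notice that j ≤ k, hence L^jη ≤ 1»*.
v1.1 (DOCFIX, docstrings only, code byte-identical to v1): the (3.11) quotation now reproduces print's subscript «D» in the
first right-hand term with a ⟦sic⟧ (v1 silently wrote the intended U; cross-read finding D1).

WHAT IS TYPED (the `𝐉`-slot of the hand certificate GAPS G-adv9-2, item (i); items (ii), (iii) are the tree's
`B12Membership313II` ∕ `B12Membership313IILie` and `B12Membership314`).  For the third argument of (3.13),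
`𝐉′ := (L^{j−1}η)³𝐉 + Δ^ξ_𝐔𝐀 − P₁𝐀 + 𝐅₁(𝐔, 𝐀)`, to lie in the `𝐉`-slot of the analyticity space `U^c_j(X, α₀, α₁)` of
`𝐄^{(j)}` one needs `|𝐉′| < γ₀ = α₀` on `X`.  INPUTS, pointwise on `X`, as HYPOTHESES: `|𝐉| < α₀` (the UN-halved third
constant of `U^c_j(X, ½α₀, ½α₁, α₀)`), `|Δ^ξ_𝐔𝐀|, |P₁𝐀| < α₂` ((3.14)), `|𝐅₁(𝐔, 𝐀)| ≤ C_F·α₂` («from the form of the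
expressions»: `𝐅₁` is local in `U, ∂U, 𝐀, ∇^ξ_U𝐀` by (3.11) and vanishes at `𝐀 = 0`; the print displays no bound, so the
absolute constant `C_F` is a PARAMETER and the bound a hypothesis), and the scaling `L^jη ≤ 1`, `L > 1`, `j ≥ 1`, so that
`(L^{j−1}η)³ ≤ L⁻³` (the (3.12) scale factor — not a halving — supplies the slack, which is why «the different constant»
`α₀` for `𝐉` is admissible).  OUTPUT: `|𝐉′| < L⁻³α₀ + (2 + C_F)α₂ ≤ α₀` under the explicit restriction
`(2 + C_F)α₂ ≤ (1 − L⁻³)α₀` (`jArg_norm_lt`, normed-space form over any real normed space; `jArg_lt`, schematic real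
form in the style of `B12CondIIIJ`; `jSlot_restriction_of_le` — e.g. `L ≥ 2` and `8(2 + C_F)α₂ ≤ 7α₀` suffice).

READING NOTES (recorded, nothing asserted).  (a) `|·|` on `𝐉`-type (current) configurations is applied pointwise; the
normed-space form covers any choice (operator ∕ Hilbert–Schmidt, DIVERGENCE D-r1.1).  (b) The bound on `𝐅₁` is the one
genuinely un-displayed input of the sentence «from the form of the expressions in (3.13)»; it is NOT derived here (that
would require the explicit (1.43)–(1.54) [14] expansion behind (3.11)) — it is carried as the hypothesis `‖F₁‖ ≤ C_F·α₂`.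
(c) Item (iv) of G-adv9-2 (condition (1.16) for the averages of `exp iξ𝐀·𝐔`) is NOT «from the definition» and is not
touched.  (d) Nothing here bears on Theorem 2 of [B12]; the file is kernel bookkeeping of one line of arithmetic.
-/

namespace Literature.MathematicalPhysics.QuantumFieldTheory.Balaban1983to89.B12Membership313J

open Literature.MathematicalPhysics.QuantumFieldTheory.Balaban1983to89
open Literature.MathematicalPhysics.QuantumFieldTheory.Balaban1983to89.B12CondIIIJ (scale_nonneg scale_le)

/-! ## §1  The scale factor of (3.12): `(L^{j−1}η)³ ≤ L⁻³` -/

/-- p. 279: `j ≥ 1`, `L^jη ≤ 1` ⟹ `(L^{j−1}η)³ ≤ (L⁻¹)³` (cube of `B12CondIIIJ.scale_le`). [folklore] -/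
theorem scale_cube_le {L η : ℝ} {j : ℕ} (hL : 0 < L) (hη : 0 ≤ η) (hj : 1 ≤ j) (hscale : L ^ j * η ≤ 1) :
    (L ^ (j - 1) * η) ^ 3 ≤ L⁻¹ ^ 3 :=
  pow_le_pow_left₀ (scale_nonneg j hL hη) (scale_le hL hη hj hscale) 3

/-! ## §2  The `𝐉`-slot of (3.13): normed-space form -/

section Normed

variable {E : Type*} [SeminormedAddCommGroup E] [NormedSpace ℝ E]

/-- **The `𝐉`-slot bound, normed form.**  For `x ≥ 0` with `x³ ≤ L⁻³` (the scale factor `x = L^{j−1}η`), `‖𝐉‖ < α₀`,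
`‖Δ𝐀‖, ‖P₁𝐀‖ < α₂`, `‖𝐅₁‖ ≤ C_F·α₂`:  `‖x³•𝐉 + Δ𝐀 − P₁𝐀 + 𝐅₁‖ < L⁻³α₀ + (2 + C_F)α₂`. [folklore] -/
theorem jArg_norm_lt_sum {L x α₀ α₂ C_F : ℝ} {J ΔA P₁A F₁ : E} (hL : 0 < L) (hx0 : 0 ≤ x) (hx : x ^ 3 ≤ L⁻¹ ^ 3)
    (hJ : ‖J‖ < α₀) (hΔ : ‖ΔA‖ < α₂) (hP : ‖P₁A‖ < α₂) (hF : ‖F₁‖ ≤ C_F * α₂) :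
    ‖x ^ 3 • J + ΔA - P₁A + F₁‖ < L⁻¹ ^ 3 * α₀ + (2 + C_F) * α₂ := by
  have hLi : 0 < L⁻¹ ^ 3 := pow_pos (inv_pos.mpr hL) 3
  have h1 : ‖x ^ 3 • J‖ ≤ L⁻¹ ^ 3 * ‖J‖ := by
    rw [norm_smul, Real.norm_eq_abs, abs_of_nonneg (pow_nonneg hx0 3)]
    exact mul_le_mul_of_nonneg_right hx (norm_nonneg J)
  have h2 : L⁻¹ ^ 3 * ‖J‖ < L⁻¹ ^ 3 * α₀ := mul_lt_mul_of_pos_left hJ hLi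
  calc ‖x ^ 3 • J + ΔA - P₁A + F₁‖ ≤ ‖x ^ 3 • J‖ + ‖ΔA‖ + ‖P₁A‖ + ‖F₁‖ := by
        calc ‖x ^ 3 • J + ΔA - P₁A + F₁‖ ≤ ‖x ^ 3 • J + ΔA - P₁A‖ + ‖F₁‖ := norm_add_le _ _
          _ ≤ ‖x ^ 3 • J + ΔA‖ + ‖P₁A‖ + ‖F₁‖ := by gcongr; exact norm_sub_le _ _
          _ ≤ ‖x ^ 3 • J‖ + ‖ΔA‖ + ‖P₁A‖ + ‖F₁‖ := by gcongr; exact norm_add_le _ _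
    _ < L⁻¹ ^ 3 * α₀ + α₂ + α₂ + C_F * α₂ := by linarith
    _ = L⁻¹ ^ 3 * α₀ + (2 + C_F) * α₂ := by ring

/-- **[B12 p. 272, (3.13)–(3.14)] — the `𝐉`-slot of the membership of (3.13)'s arguments in the analyticity space
`U^c_j(X, α₀, α₁)` (γ₀ = α₀): for `(𝐔, 𝐉) ∈ U^c_j(X, ½α₀, ½α₁, α₀)` («notice the different constant in the bound for 𝐉»:
`|𝐉| < α₀` un-halved), `𝐀` with (3.14) (`|Δ^ξ_𝐔𝐀|, |P₁𝐀| < α₂`), the local term `𝐅₁(𝐔, 𝐀)` of (3.11)∕(3.13) bounded by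
`C_F·α₂` (hypothesis — «from the form of the expressions», no printed display) and the scaling `j ≥ 1`, `L^jη ≤ 1`
(p. 279), the third argument `𝐉′ = (L^{j−1}η)³𝐉 + Δ^ξ_𝐔𝐀 − P₁𝐀 + 𝐅₁(𝐔, 𝐀)` satisfies (1.14)'s `|𝐉′| < α₀` at the point,
under the explicit restriction `(2 + C_F)α₂ ≤ (1 − L⁻³)α₀` on `α₂` («α₂, depending on α₀ and on some absolute
constants»).**  Any real normed space `E` (pointwise values of current-type configurations).
[cite: Balaban1987RG1, p. 272 (3.11)–(3.14) with (1.14) p. 262 and the γ₀ = α₀ convention p. 263 — the 𝐉-slot of «These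
restrictions can be easily obtained from the definition of the spaces, and from the form of the expressions in (3.13)»;
the proof and the explicit restriction are ours, the 𝐅₁-bound is a hypothesis] -/
theorem jArg_norm_lt {L η α₀ α₂ C_F : ℝ} {j : ℕ} {J ΔA P₁A F₁ : E} (hL : 1 < L) (hη : 0 ≤ η) (hj : 1 ≤ j)
    (hscale : L ^ j * η ≤ 1) (hJ : ‖J‖ < α₀) (hΔ : ‖ΔA‖ < α₂) (hP : ‖P₁A‖ < α₂) (hF : ‖F₁‖ ≤ C_F * α₂)
    (hres : (2 + C_F) * α₂ ≤ (1 - L⁻¹ ^ 3) * α₀) :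
    ‖(L ^ (j - 1) * η) ^ 3 • J + ΔA - P₁A + F₁‖ < α₀ := by
  have hL0 : 0 < L := lt_trans zero_lt_one hL
  calc ‖(L ^ (j - 1) * η) ^ 3 • J + ΔA - P₁A + F₁‖ < L⁻¹ ^ 3 * α₀ + (2 + C_F) * α₂ :=
        jArg_norm_lt_sum hL0 (scale_nonneg j hL0 hη) (scale_cube_le hL0 hη hj hscale) hJ hΔ hP hF
    _ ≤ L⁻¹ ^ 3 * α₀ + (1 - L⁻¹ ^ 3) * α₀ := by linarith
    _ = α₀ := by ring

end Normed

/-! ## §3  Schematic real form (style of `B12CondIIIJ`: each `|·|` a real number carrying its bound as a hypothesis) -/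

/-- **The `𝐉`-slot bound, schematic real form**: `x = L^{j−1}η` with `j ≥ 1`, `L^jη ≤ 1`, `L > 1`; reals `nJ = |𝐉| < α₀`,
`nΔ = |Δ^ξ_𝐔𝐀| < α₂`, `nP = |P₁𝐀| < α₂`, `nF = |𝐅₁(𝐔,𝐀)| ≤ C_F·α₂`, and any real `nJ′` with the triangle inequality
`nJ′ ≤ x³·nJ + nΔ + nP + nF` (= `|𝐉′|`): then `nJ′ < α₀` under `(2 + C_F)α₂ ≤ (1 − L⁻³)α₀`.
[cite: Balaban1987RG1, p. 272 (3.13)–(3.14) with (1.14) p. 262 — 𝐉-slot, schematic form; proof and restriction ours] -/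
theorem jArg_lt {L η α₀ α₂ C_F nJ nΔ nP nF nJ' : ℝ} {j : ℕ} (hL : 1 < L) (hη : 0 ≤ η) (hj : 1 ≤ j)
    (hscale : L ^ j * η ≤ 1) (hnJ : 0 ≤ nJ) (hJ : nJ < α₀) (hΔ : nΔ < α₂) (hP : nP < α₂) (hF : nF ≤ C_F * α₂)
    (htri : nJ' ≤ (L ^ (j - 1) * η) ^ 3 * nJ + nΔ + nP + nF) (hres : (2 + C_F) * α₂ ≤ (1 - L⁻¹ ^ 3) * α₀) :
    nJ' < α₀ := by
  have hL0 : 0 < L := lt_trans zero_lt_one hL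
  have hLi : 0 < L⁻¹ ^ 3 := pow_pos (inv_pos.mpr hL0) 3
  have hx3 : (L ^ (j - 1) * η) ^ 3 ≤ L⁻¹ ^ 3 := scale_cube_le hL0 hη hj hscale
  have h1 : (L ^ (j - 1) * η) ^ 3 * nJ ≤ L⁻¹ ^ 3 * nJ := mul_le_mul_of_nonneg_right hx3 hnJ
  have h2 : L⁻¹ ^ 3 * nJ < L⁻¹ ^ 3 * α₀ := mul_lt_mul_of_pos_left hJ hLi
  nlinarith

/-- **An admissible instance of the restriction**: `L ≥ 2` and `8(2 + C_F)α₂ ≤ 7α₀` (with `α₀ ≥ 0`) give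
`(2 + C_F)α₂ ≤ (1 − L⁻³)α₀` — so `α₂ ≤ 7α₀ ∕ (8(2 + C_F))` is «a constant α₂, depending on α₀ and on some absolute
constants». [folklore] -/
theorem jSlot_restriction_of_le {L α₀ α₂ C_F : ℝ} (hL : 2 ≤ L) (hα₀ : 0 ≤ α₀)
    (h : 8 * ((2 + C_F) * α₂) ≤ 7 * α₀) : (2 + C_F) * α₂ ≤ (1 - L⁻¹ ^ 3) * α₀ := by
  have hL0 : 0 < L := by linarith
  have hLi : L⁻¹ ≤ 1 / 2 := by rw [inv_eq_one_div]; exact div_le_div_of_nonneg_left zero_le_one (by norm_num) hL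
  have hLi0 : 0 ≤ L⁻¹ := (inv_pos.mpr hL0).le
  have h3 : L⁻¹ ^ 3 ≤ (1 / 2) ^ 3 := pow_le_pow_left₀ hLi0 hLi 3
  nlinarith

/-- **The `𝐉`-slot under the admissible instance** `L ≥ 2`, `8(2 + C_F)α₂ ≤ 7α₀` (normed form). [folklore] -/
theorem jArg_norm_lt_of_le {E : Type*} [SeminormedAddCommGroup E] [NormedSpace ℝ E] {L η α₀ α₂ C_F : ℝ} {j : ℕ}
    {J ΔA P₁A F₁ : E} (hL : 2 ≤ L) (hη : 0 ≤ η) (hj : 1 ≤ j) (hscale : L ^ j * η ≤ 1) (hJ : ‖J‖ < α₀)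
    (hΔ : ‖ΔA‖ < α₂) (hP : ‖P₁A‖ < α₂) (hF : ‖F₁‖ ≤ C_F * α₂) (h : 8 * ((2 + C_F) * α₂) ≤ 7 * α₀) :
    ‖(L ^ (j - 1) * η) ^ 3 • J + ΔA - P₁A + F₁‖ < α₀ :=
  jArg_norm_lt (by linarith) hη hj hscale hJ hΔ hP hF
    (jSlot_restriction_of_le hL ((norm_nonneg J).trans hJ.le) h)

end Literature.MathematicalPhysics.QuantumFieldTheory.Balaban1983to89.B12Membership313J
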